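import Summits.CriticalPhenomena.CardyFormulaZ2.Theorems.CardyQContinuationUniformZeroFreeOddsConeEnvelope

/-!
# Envelope of arc zero-freeness (crux `UniformZeroFree`, stmt-CriticalPhenomena-5559)

Notation of the route `CardyQContinuation`: for a conformal rectangle `R`, mesh `δ` and complex
`s`, `w_s(ω) = s^(|ω| + 2 k_B(ω))` is the self-dual arc weight of a bond configuration
`ω ⊆ E(Ω_δ)`, `Z_δ(s) = Σ_ω w_s(ω)` the arc partition function and `N_δ(s) = Σ_{ω ∈ C_δ} w_s(ω)`
its crossing-restricted part.  The registered stub `stub_arcZeroFree` of the line `birth` asks for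
`ρ > 0` with `Z_δ(s) ≠ 0` for all complex `s` within `ρ` of `[1, √2]`, for all small `δ` —
UNIFORMLY in `δ`; the crux adds `‖N_δ/Z_δ‖ ≤ M` there.  This file proves the provable envelope:

* `arcZ_realAxis` — at real `t > 0` (and `δ > 0`) `Z_δ(t)` is a strictly positive real and
  `0 ≤ N_δ(t) ≤ Z_δ(t)`, so `‖N_δ(t)/Z_δ(t)‖ ≤ 1` (`arcZ_norm_ratio_le_one_real`);
* `arcZ_pointwise` — arc zero-freeness POINTWISE in `δ`: for every `δ > 0` there is `ρ > 0`
  (depending on `δ`) with `Z_δ ≠ 0` on the `ρ`-thickening of `[1, √2]`;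
* `arcZ_crux_pointwise` — the whole crux POINTWISE in `δ`: for every `δ > 0` there are `ρ > 0`
  and `M` with `Z_δ(s) ≠ 0 ∧ ‖N_δ(s)/Z_δ(s)‖ ≤ M` on the `ρ`-thickening (continuity on a compact
  closed thickening inside the zero-free one).

So the entire content of the stub and of the crux is the uniformity of `ρ` (and `M`) in `δ`.
The generic finite-sum lemmas are stated for an arbitrary finite index set `F` and exponents `m`;
for `δ > 0` the configurations `ω ⊆ E(Ω_δ)` form a finite set (`finite_powerset_edgeSet`), which
converts the route's `finsum`s into `Finset` sums (`finsum_mem_eq_finite_toFinset_sum`).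
Exact transfer-matrix numerics attached to the item (kit j023079: certified root enclosures for
34 grids up to `10 × 10`, `20 × 10`, `27 × 9`) find the nearest zeros of `Z_δ` at `s = 0`
(distance `1`) and `s = −1` (distance `2`), the nearest genuinely complex ones at distance `≥ 2.4`.
-/

namespace Summit.CriticalPhenomena.CardyFormulaZ2.Theorems.UniformZeroFree

open Filter Metric Set
open scoped Topology ComplexConjugate
open Literature.Probability.LatticeModels Literature.Probability.Percolation
open Literature.Probability.RandomPlanarGeometry
open Summit.CriticalPhenomena.CardyFormulaZ2.Theorems.CardyQContinuation

noncomputable section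

/-! ## Generic finite sums of monomials -/

/-- At a real point a sum of monomials is the real sum, cast to `ℂ`. [folklore] -/
theorem arcZ_sum_pow_ofReal {α : Type*} (F : Finset α) (m : α → ℕ) (t : ℝ) :
    (∑ a ∈ F, (t : ℂ) ^ m a) = ((∑ a ∈ F, t ^ m a : ℝ) : ℂ) := by
  rw [Complex.ofReal_sum]
  exact Finset.sum_congr rfl fun a _ => by simp

/-- A nonempty real sum of monomials is strictly positive at `t > 0`. [folklore] -/
theorem arcZ_sum_pow_pos {α : Type*} {F : Finset α} (hF : F.Nonempty) (m : α → ℕ) {t : ℝ}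
    (ht : 0 < t) : 0 < ∑ a ∈ F, t ^ m a :=
  Finset.sum_pos (fun a _ => pow_pos ht (m a)) hF

/-- A restricted real sum of monomials is dominated by the full sum (`t ≥ 0`). [folklore] -/
theorem arcZ_sum_indicator_le_sum {α : Type*} (F : Finset α) (C : Set α) (m : α → ℕ) {t : ℝ}
    (ht : 0 ≤ t) : ∑ a ∈ F, C.indicator (fun b => t ^ m b) a ≤ ∑ a ∈ F, t ^ m a :=
  Finset.sum_le_sum fun a _ =>
    Set.indicator_le_self' (fun _ _ => pow_nonneg ht (m a)) a

/-- A sum of monomials is continuous in `s`. [folklore] -/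
theorem arcZ_continuous_sum_pow {α : Type*} (F : Finset α) (m : α → ℕ) :
    Continuous fun s : ℂ => ∑ a ∈ F, s ^ m a :=
  continuous_finsetSum F fun a _ => continuous_pow (m a)

/-- **Real axis, finite-sum form.** For a nonempty finite index set `F`, exponents `m`, an event
`C` and real `t > 0`: `Z(t) = Σ_F t^{m a}` is a strictly positive real, `N(t) = Σ_F 𝟙_C t^{m a}` is
a real with `0 ≤ N(t) ≤ Z(t)`, hence `‖N(t)/Z(t)‖ ≤ 1`. [folklore] -/
theorem arcZ_realAxis_finset {α : Type*} {F : Finset α} (hF : F.Nonempty) (C : Set α)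
    (m : α → ℕ) {t : ℝ} (ht : 0 < t) :
    ((∑ a ∈ F, (t : ℂ) ^ m a).im = 0 ∧ 0 < (∑ a ∈ F, (t : ℂ) ^ m a).re) ∧
      ((∑ a ∈ F, C.indicator (fun b => (t : ℂ) ^ m b) a).im = 0 ∧
        0 ≤ (∑ a ∈ F, C.indicator (fun b => (t : ℂ) ^ m b) a).re ∧
        (∑ a ∈ F, C.indicator (fun b => (t : ℂ) ^ m b) a).re ≤ (∑ a ∈ F, (t : ℂ) ^ m a).re) ∧
      ‖(∑ a ∈ F, C.indicator (fun b => (t : ℂ) ^ m b) a) / ∑ a ∈ F, (t : ℂ) ^ m a‖ ≤ 1 := by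
  rw [arcZ_sum_pow_ofReal, oddsCone_sum_indicator_ofReal]
  have hZ := arcZ_sum_pow_pos hF m ht
  have hN := oddsCone_sum_indicator_nonneg F C m ht.le
  have hNZ := arcZ_sum_indicator_le_sum F C m ht.le
  refine ⟨⟨Complex.ofReal_im _, by rwa [Complex.ofReal_re]⟩,
    ⟨Complex.ofReal_im _, by rwa [Complex.ofReal_re], by rwa [Complex.ofReal_re, Complex.ofReal_re]⟩,
    ?_⟩
  rw [← Complex.ofReal_div, Complex.norm_real, Real.norm_eq_abs, abs_le]
  constructor
  · have : 0 ≤ (∑ a ∈ F, C.indicator (fun b => t ^ m b) a) / ∑ a ∈ F, t ^ m a :=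
      div_nonneg hN hZ.le
    linarith
  · exact (div_le_one hZ).2 hNZ

/-- **Pointwise zero-freeness for finite sums of monomials.** For a nonempty finite index set `F`,
exponents `m` and a compact set `K ⊆ (0, ∞)` of reals there is `ρ > 0` such that
`Σ_F s^{m a} ≠ 0` for all complex `s` within `ρ` of `K` (the sum is a strictly positive real on
`K`, continuous, and `IsCompact.exists_thickening_subset_open` applies to `{Z ≠ 0}`). [folklore] -/
theorem arcZ_pointwise_finset {α : Type*} {F : Finset α} (hF : F.Nonempty) (m : α → ℕ)
    {K : Set ℝ} (hK : IsCompact K) (hKpos : ∀ t ∈ K, 0 < t) :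
    ∃ ρ > (0 : ℝ), ∀ s ∈ Metric.thickening ρ (((↑) : ℝ → ℂ) '' K), (∑ a ∈ F, s ^ m a) ≠ 0 := by
  have hU : IsOpen {s : ℂ | (∑ a ∈ F, s ^ m a) ≠ 0} :=
    isOpen_ne_fun (arcZ_continuous_sum_pow F m) continuous_const
  have hsub : ((↑) : ℝ → ℂ) '' K ⊆ {s : ℂ | (∑ a ∈ F, s ^ m a) ≠ 0} := by
    rintro _ ⟨t, ht, rfl⟩
    have h := (arcZ_realAxis_finset hF ∅ m (hKpos t ht)).1.2
    show (∑ a ∈ F, (t : ℂ) ^ m a) ≠ 0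
    intro h0
    rw [h0, Complex.zero_re] at h
    exact lt_irrefl 0 h
  obtain ⟨ρ, hρ, hρsub⟩ := (hK.image Complex.continuous_ofReal).exists_thickening_subset_open hU hsub
  exact ⟨ρ, hρ, fun s hs => hρsub hs⟩

/-- **Pointwise crux for finite sums of monomials.** For a nonempty finite index set `F`,
exponents `m`, an event `C` and a compact set `K ⊆ (0, ∞)` of reals there are `ρ > 0` and `M`
such that `Z(s) = Σ_F s^{m a} ≠ 0` and `‖N(s)/Z(s)‖ ≤ M` (`N = Σ_F 𝟙_C s^{m a}`) for all complex
`s` within `ρ` of `K`: take half the zero-free radius, so that the closed thickening is a compact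
subset of the zero-free open one, on which `N/Z` is continuous, hence bounded. [folklore] -/
theorem arcZ_crux_pointwise_finset {α : Type*} {F : Finset α} (hF : F.Nonempty) (C : Set α)
    (m : α → ℕ) {K : Set ℝ} (hK : IsCompact K) (hKpos : ∀ t ∈ K, 0 < t) :
    ∃ ρ > (0 : ℝ), ∃ M : ℝ, ∀ s ∈ Metric.thickening ρ (((↑) : ℝ → ℂ) '' K),
      (∑ a ∈ F, s ^ m a) ≠ 0 ∧
        ‖(∑ a ∈ F, C.indicator (fun b => s ^ m b) a) / ∑ a ∈ F, s ^ m a‖ ≤ M := by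
  obtain ⟨ρ₀, hρ₀, h0⟩ := arcZ_pointwise_finset hF m hK hKpos
  set K' : Set ℂ := ((↑) : ℝ → ℂ) '' K with hK'
  have hK'c : IsCompact K' := hK.image Complex.continuous_ofReal
  -- the closed (ρ₀/2)-thickening is compact and inside the zero-free ρ₀-thickening
  have hcl : Metric.cthickening (ρ₀ / 2) K' ⊆ Metric.thickening ρ₀ K' :=
    Metric.cthickening_subset_thickening' hρ₀ (by linarith) K'
  have hcpt : IsCompact (Metric.cthickening (ρ₀ / 2) K') := hK'c.cthickening
  have hcont : ContinuousOn
      (fun s : ℂ => (∑ a ∈ F, C.indicator (fun b => s ^ m b) a) / ∑ a ∈ F, s ^ m a)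
      (Metric.cthickening (ρ₀ / 2) K') := by
    refine ContinuousOn.div (oddsCone_continuous_sum_indicator F C m).continuousOn
      (arcZ_continuous_sum_pow F m).continuousOn fun s hs => h0 s (hcl hs)
  obtain ⟨M, hM⟩ := hcpt.exists_bound_of_continuousOn hcont
  refine ⟨ρ₀ / 2, by positivity, M, fun s hs => ⟨h0 s ?_, hM s ?_⟩⟩
  · exact Metric.thickening_mono (by linarith) K' hs
  · exact Metric.thickening_subset_cthickening _ _ hs

end

/-! ## The envelope on the route's objects

The statements below use the SAME `let w := …; let Z := …; let N := …` bindings as the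
registered stub `stub_arcZeroFree` and the crux `UniformZeroFree`, so after `dsimp only` they
speak about literally the same terms. -/

/-- For `δ > 0` the finite set of configurations `ω ⊆ E(Ω_δ)` is nonempty (it contains `∅`).
[folklore] -/
theorem arcZ_toFinset_powerset_nonempty (R : ConformalRectangle) {δ : ℝ} (hδ : 0 < δ) :
    (finite_powerset_edgeSet (Ω := R.carrier) R.isBounded hδ).toFinset.Nonempty :=
  ⟨∅, by simp⟩

/-- **(A1) Real axis.** For a conformal rectangle `R`, mesh `δ > 0` and real `t > 0`: the
self-dual arc partition function `Z_δ(t)` is a strictly positive real, the crossing part `N_δ(t)`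
is a real with `0 ≤ N_δ(t) ≤ Z_δ(t)`, and `‖N_δ(t)/Z_δ(t)‖ ≤ 1`. [folklore] -/
theorem arcZ_realAxis :
    let w : Literature.Probability.RandomPlanarGeometry.ConformalRectangle → ℝ → ℂ →
        Set (Sym2 (Literature.Probability.LatticeModels.Site 2)) → ℂ :=
      fun R δ s ω ↦ s ^ (ω.ncard + 2 * Nat.card ((Literature.Probability.Percolation.openGraph ω ⊔
        Literature.Probability.LatticeModels.wired
          (Literature.Probability.LatticeModels.discreteArc R.carrier δ (R.arc 0) ∪
            Literature.Probability.LatticeModels.discreteArc R.carrier δ (R.arc 2))).induce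
        (Literature.Probability.LatticeModels.meshDomain R.carrier δ)).ConnectedComponent)
    let Z : Literature.Probability.RandomPlanarGeometry.ConformalRectangle → ℝ → ℂ → ℂ :=
      fun R δ s ↦ ∑ᶠ ω ∈ 𝒫 (Literature.Probability.LatticeModels.discreteDomainGraph
        R.carrier δ).edgeSet, w R δ s ω
    let N : Literature.Probability.RandomPlanarGeometry.ConformalRectangle → ℝ → ℂ → ℂ :=
      fun R δ s ↦ ∑ᶠ ω ∈ 𝒫 (Literature.Probability.LatticeModels.discreteDomainGraph
        R.carrier δ).edgeSet, (Literature.Probability.Percolation.discreteCrossing R.carrier δ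
          (R.arc 0) (R.arc 2)).indicator (w R δ s) ω
    ∀ R : Literature.Probability.RandomPlanarGeometry.ConformalRectangle, ∀ δ : ℝ, 0 < δ →
      ∀ t : ℝ, 0 < t →
        ((Z R δ t).im = 0 ∧ 0 < (Z R δ t).re) ∧
          ((N R δ t).im = 0 ∧ 0 ≤ (N R δ t).re ∧ (N R δ t).re ≤ (Z R δ t).re) ∧
          ‖N R δ t / Z R δ t‖ ≤ 1 := by
  dsimp only
  intro R δ hδ t ht
  have hfin := finite_powerset_edgeSet R.isBounded hδ
  simp only [finsum_mem_eq_finite_toFinset_sum _ hfin]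
  exact arcZ_realAxis_finset (arcZ_toFinset_powerset_nonempty R hδ) _ _ ht

/-- **(A2) Arc zero-freeness, POINTWISE in `δ`.** For every conformal rectangle `R` and every mesh
`δ > 0` there is `ρ > 0` (depending on `δ`) such that `Z_δ(s) ≠ 0` for all complex `s` within `ρ`
of the segment `[1, √2]`.  This is the registered stub `stub_arcZeroFree` with the quantifiers
`∃ ρ` and `∀ᶠ δ` swapped (its `let`s written out, i.e. the `dsimp only`-normal form): the whole
content of the stub is the uniformity of `ρ` in `δ`. [folklore] -/
theorem arcZ_pointwise : ∀ R : Literature.Probability.RandomPlanarGeometry.ConformalRectangle, ∀ δ : ℝ, 0 < δ → ∃ ρ > (0:ℝ), ∀ s ∈ Metric.thickening ρ (((↑) : ℝ → ℂ) '' Set.Icc (1:ℝ) (Real.sqrt 2)), (∑ᶠ ω ∈ 𝒫 (Literature.Probability.LatticeModels.discreteDomainGraph R.carrier δ).edgeSet, s ^ (ω.ncard + 2 * Nat.card ((Literature.Probability.Percolation.openGraph ω ⊔ Literature.Probability.LatticeModels.wired (Literature.Probability.LatticeModels.discreteArc R.carrier δ (R.arc 0) ∪ Literature.Probability.LatticeModels.discreteArc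 R.carrier δ (R.arc 2))).induce (Literature.Probability.LatticeModels.meshDomain R.carrier δ)).ConnectedComponent)) ≠ 0 := by
  intro R δ hδ
  have hfin := finite_powerset_edgeSet R.isBounded hδ
  simp only [finsum_mem_eq_finite_toFinset_sum _ hfin]
  exact arcZ_pointwise_finset (arcZ_toFinset_powerset_nonempty R hδ) _ isCompact_Icc
    fun t ht => one_pos.trans_le ht.1

/-- **(A3) The crux `UniformZeroFree`, POINTWISE in `δ`.** For every conformal rectangle `R` and
every mesh `δ > 0` there are `ρ > 0` and `M` (depending on `δ`) such that for all complex `s`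
within `ρ` of `[1, √2]`: `Z_δ(s) ≠ 0` and `‖N_δ(s)/Z_δ(s)‖ ≤ M`.  (The crux asks for `ρ, M`
independent of `δ`; written in the `dsimp only`-normal form of the crux's `let`s.) [folklore] -/
theorem arcZ_crux_pointwise : ∀ R : Literature.Probability.RandomPlanarGeometry.ConformalRectangle, ∀ δ : ℝ, 0 < δ → ∃ ρ > (0:ℝ), ∃ M : ℝ, ∀ s ∈ Metric.thickening ρ (((↑) : ℝ → ℂ) '' Set.Icc (1:ℝ) (Real.sqrt 2)), (∑ᶠ ω ∈ 𝒫 (Literature.Probability.LatticeModels.discreteDomainGraph R.carrier δ).edgeSet, s ^ (ω.ncard + 2 * Nat.card ((Literature.Probability.Percolation.openGraph ω ⊔ Literature.Probability.LatticeModels.wired (Literature.Probability.LatticeModels.discreteArc R.carrier δ (R.arc 0) ∪ Literature.Probability.LatticeModels.discreteArc R.carrier δ (R.arc 2))).induce (Literature.Probability.LatticeModels.meshDomain R.carrier δ)).ConnectedComponent)) ≠ 0 ∧ ‖(∑ᶠ ω ∈ 𝒫 (Literature.Probability.LatticeModels.discreteDomainGraph R.carrier δ).edgeSet, (Literature.Probability.Percolation.discreteCrossing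 R.carrier δ (R.arc 0) (R.arc 2)).indicator (fun ω ↦ s ^ (ω.ncard + 2 * Nat.card ((Literature.Probability.Percolation.openGraph ω ⊔ Literature.Probability.LatticeModels.wired (Literature.Probability.LatticeModels.discreteArc R.carrier δ (R.arc 0) ∪ Literature.Probability.LatticeModels.discreteArc R.carrier δ (R.arc 2))).induce (Literature.Probability.LatticeModels.meshDomain R.carrier δ)).ConnectedComponent)) ω) / (∑ᶠ ω ∈ 𝒫 (Literature.Probability.LatticeModels.discreteDomainGraph R.carrier δ).edgeSet, s ^ (ω.ncard + 2 * Nat.card ((Literature.Probability.Percolation.openGraph ω ⊔ Literature.Probability.LatticeModels.wired (Literature.Probability.LatticeModels.discreteArc R.carrier δ (R.arc 0) ∪ Literature.Probability.LatticeModels.discreteArc R.carrier δ (R.arc 2))).induce (Literature.Probability.LatticeModels.meshDomain R.carrier δ)).ConnectedComponent))‖ ≤ M := by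
  intro R δ hδ
  have hfin := finite_powerset_edgeSet R.isBounded hδ
  simp only [finsum_mem_eq_finite_toFinset_sum _ hfin]
  exact arcZ_crux_pointwise_finset (arcZ_toFinset_powerset_nonempty R hδ) _ _ isCompact_Icc
    fun t ht => one_pos.trans_le ht.1

end Summit.CriticalPhenomena.CardyFormulaZ2.Theorems.UniformZeroFree
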